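import Summits.NavierStokesRegularity.FunctionalMining.BiaxialEikonalObstruction
import HarnessLib

/-!
# FunctionalMining — the eikonal obstruction for an ARBITRARY direction of invariance: strain translation
# rigidity and (4b)(ii) of `SIEVELD.md` §3.4b along any `K ∈ ℝ^d ∖ {0}`, rational or not

Search for candidate a priori estimates; no regularity claim. Cell `pub-nsfunc`, prove seat (gen 20).
Static calculus of smooth fields on the flat torus; nothing about Navier–Stokes dynamics.
`BiaxialEikonalObstruction` treats invariance along a COORDINATE direction `eₖ`; here the direction of
invariance is an arbitrary vector `K` (for irrational `K` the translates `x + proj(tK)` are dense in a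
subtorus — the hypothesis is then stronger, the theorem the same).

* `dirDeriv_eq_zero_of_forall_add_proj`: a `C¹` function invariant under `x ↦ x + proj(tK)` has
  `∑ₗ Kₗ ∂ₗ f = 0` (`Torus.lineDeriv` along `K` vanishes; `lineDeriv = ∑ₗ Kₗ∂ₗ` for `C¹` functions).
* **`dirDeriv_eq_zero_of_strain_invariant_dir`** (strain translation rigidity, any direction): if `S(v)` is
  invariant under `x ↦ x + proj(tK)` then `∂_K v := ∑ₗ Kₗ ∂ₗ v ≡ 0` (`∂_K v` is a Killing field:
  `killing_parallel`, then zero mean).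
* **`exists_strain_mulVec_eq_zero_dir`** (degeneracy, any direction): if `∂_K v ≡ 0` then at a maximum point
  `p` of `K·v`, `S(v)(p) K = ½(∂_K v + ∇(K·v))(p) = 0` — the strain annihilates `K` somewhere.
* **`no_biaxial_strain_of_axis_invariant_dir`**: no smooth `v` has `S(v) = m(1 − 3n⊗n)`, `m ≠ 0`, `|n| = 1`,
  with `n(x + proj(tK)) = n(x)` for all `x, t` and some `K ≠ 0`: `S(p)K = m(K − 3(n·K)n) = 0` forces
  `n·K = 3(n·K)`, so `n·K = 0` and `K = 0`. (4b)(ii) = the case `K = eₖ`.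
[ours = assembly; folklore = tools]
-/

noncomputable section

open MeasureTheory Set Filter Topology

namespace Summit.NavierStokesRegularity.FunctionalMining
open Literature.Analysis Literature.Analysis.FunctionSpaces Literature.Analysis.FunctionSpaces.Torus
  Literature.Analysis.FluidPDE

namespace BiaxialEikonal

variable {d : Type*} [Fintype d] [DecidableEq d]
variable {F : Type*} [NormedAddCommGroup F] [NormedSpace ℝ F]

/-! ## 1. Directional derivatives of invariant functions -/

/-- A `C¹` function invariant under the translations `x ↦ x + proj(tK)` has vanishing derivative along `K`:
`∑ₗ Kₗ ∂ₗ f (x) = 0`. [folklore] -/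
theorem dirDeriv_eq_zero_of_forall_add_proj {f : UnitAddTorus d → F} (hf : Torus.IsContDiff 1 f)
    (K : EuclideanSpace ℝ d) {x : UnitAddTorus d} (h : ∀ t : ℝ, f (x + proj (t • K)) = f x) :
    ∑ l, K l • Torus.partialDeriv l f x = 0 := by
  rw [← fderiv_apply_eq_sum_partialDeriv hf, ← lineDeriv_eq_fderiv_apply hf]
  show deriv (fun t : ℝ => f (x + proj (t • K))) 0 = 0
  rw [show (fun t : ℝ => f (x + proj (t • K))) = fun _ => f x from funext h]
  exact deriv_const 0 (f x)

/-! ## 2. Strain translation rigidity along an arbitrary direction -/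

section Field

variable {v : UnitAddTorus d → EuclideanSpace ℝ d} (hv : Torus.IsSmooth v) (K : EuclideanSpace ℝ d)
include hv

/-- The directional derivative field `∂_K v = ∑ₗ Kₗ ∂ₗ v` is smooth. [folklore] -/
theorem isSmooth_dirDeriv : Torus.IsSmooth (fun y => ∑ l, K l • Torus.partialDeriv l v y) :=
  ContDiff.sum fun l _ => ContDiff.const_smul (K l) (hv.partialDeriv l)

/-- Components of `∂_K v` and their partials: `∂ⱼ(∂_K v)ᵢ = ∑ₗ Kₗ (∂ⱼ∂ₗ v)ᵢ`. [folklore] -/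
theorem partialDeriv_dirDeriv_apply (j i : d) (x : UnitAddTorus d) :
    Torus.partialDeriv j (fun y => ∑ l, K l • Torus.partialDeriv l v y) x i =
      ∑ l, K l * Torus.partialDeriv j (Torus.partialDeriv l v) x i := by
  rw [← partialDeriv_apply_coord ((isSmooth_dirDeriv hv K).isContDiff (by simp)) j x i]
  have hfun : (fun y => (∑ l, K l • Torus.partialDeriv l v y) i) =
      fun y => ∑ l, K l * Torus.partialDeriv l v y i := by
    funext y; simp [Finset.sum_apply]
  rw [hfun, partialDeriv_finset_sum _ (fun l _ => ?_)]
  · refine Finset.sum_congr rfl fun l _ => ?_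
    rw [show (fun y => K l * Torus.partialDeriv l v y i) = K l • fun y => Torus.partialDeriv l v y i from rfl,
      partialDeriv_const_smul (((hv.partialDeriv l).apply i).isContDiff (by simp)), Pi.smul_apply, smul_eq_mul,
      partialDeriv_apply_coord ((hv.partialDeriv l).isContDiff (by simp))]
  · exact ContDiff.mul contDiff_const (((hv.partialDeriv l).apply i).isContDiff (by simp))

/-- **STRAIN TRANSLATION RIGIDITY, ARBITRARY DIRECTION.** If the strain matrix of a smooth field `v` is
invariant under the translations `x ↦ x + proj(tK)`, then `∂_K v = ∑ₗ Kₗ∂ₗ v ≡ 0`: `∂_K v` is a Killing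
field of the flat torus (its strain is `∂_K` of the strain of `v`), hence parallel and constant
(`killing_parallel`), and its mean `∑ₗ Kₗ ∫∂ₗvᵢ = 0` vanishes. [ours] -/
theorem dirDeriv_eq_zero_of_strain_invariant_dir
    (hS : ∀ (x : UnitAddTorus d) (t : ℝ), torusStrainMatrix v (x + proj (t • K)) = torusStrainMatrix v x)
    (x : UnitAddTorus d) : ∑ l, K l • Torus.partialDeriv l v x = 0 := by
  set w : UnitAddTorus d → EuclideanSpace ℝ d := fun y => ∑ l, K l • Torus.partialDeriv l v y with hw
  have hws : Torus.IsSmooth w := isSmooth_dirDeriv hv K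
  -- `w` is Killing: `∂ⱼwᵢ + ∂ᵢwⱼ = ∑ₗ Kₗ ∂ₗ(∂ⱼvᵢ + ∂ᵢvⱼ) = ∂_K (2 Sᵢⱼ) = 0`
  have hK : ∀ y i j, Torus.partialDeriv j w y i + Torus.partialDeriv i w y j = 0 := by
    intro y i j
    rw [hw, partialDeriv_dirDeriv_apply hv K j i y, partialDeriv_dirDeriv_apply hv K i j y,
      ← Finset.sum_add_distrib]
    have hc : ∀ a b : d, Torus.IsContDiff 1 (fun z => Torus.partialDeriv a v z b) :=
      fun a b => ((hv.partialDeriv a).apply b).isContDiff (by simp)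
    have hcij : Torus.IsContDiff 1 (fun z => Torus.partialDeriv j v z i + Torus.partialDeriv i v z j) :=
      ContDiff.add (hc j i) (hc i j)
    have hinv := dirDeriv_eq_zero_of_forall_add_proj hcij K (x := y) (fun t => by
        have h := congrFun (congrFun (hS y t) i) j
        rw [torusStrainMatrix_apply, torusStrainMatrix_apply] at h
        show Torus.partialDeriv j v (y + proj (t • K)) i + Torus.partialDeriv i v (y + proj (t • K)) j =
          Torus.partialDeriv j v y i + Torus.partialDeriv i v y j
        linarith)
    rw [← hinv]
    refine Finset.sum_congr rfl fun l _ => ?_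
    rw [smul_eq_mul, show (fun z => Torus.partialDeriv j v z i + Torus.partialDeriv i v z j) =
        (fun z => Torus.partialDeriv j v z i) + fun z => Torus.partialDeriv i v z j from rfl,
      partialDeriv_add (hc j i) (hc i j), Pi.add_apply,
      partialDeriv_apply_coord ((hv.partialDeriv j).isContDiff (by simp)),
      partialDeriv_apply_coord ((hv.partialDeriv i).isContDiff (by simp)),
      partialDeriv_comm hv l j y, partialDeriv_comm hv l i y]
    ring
  have hpar : ∀ j y, Torus.partialDeriv j w y = 0 := fun j y => killing_parallel hws hK j y
  have hcomp : ∀ i, w x i = 0 := by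
    intro i
    have h1 : Torus.IsContDiff 1 (fun y => w y i) := (hws.apply i).isContDiff (by simp)
    refine eq_zero_of_forall_partialDeriv_eq_zero h1 (fun j y => ?_) ?_ x
    · rw [partialDeriv_apply_coord (hws.isContDiff (by simp)) j y i, hpar j y]
      rfl
    · have hwi : (fun y => w y i) = fun y => ∑ l, K l * Torus.partialDeriv l (fun z => v z i) y := by
        funext y
        simp only [hw]
        simp [partialDeriv_apply_coord (hv.isContDiff (by simp))]
      rw [hwi, integral_finsetSum _ fun l _ => (((hv.apply i).partialDeriv l).integrable.const_mul (K l))]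
      exact Finset.sum_eq_zero fun l _ => by
        rw [integral_const_mul, integral_partialDeriv_eq_zero_holds (hv.apply i) l, mul_zero]
  ext i
  exact hcomp i

/-! ## 3. Degeneracy along an arbitrary direction -/

/-- **DEGENERACY, ARBITRARY DIRECTION.** If `∂_K v ≡ 0` then at a maximum point `p` of the periodic
function `K·v` the strain annihilates `K`: `∑ⱼ S(v)(p)ᵢⱼ Kⱼ = ½((∂_K v)ᵢ + ∂ᵢ(K·v))(p) = 0` for every `i`.
[ours; elementary] -/
theorem exists_strain_mulVec_eq_zero_dir (hK : ∀ x, ∑ l, K l • Torus.partialDeriv l v x = 0) :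
    ∃ p, ∀ i, ∑ j, torusStrainMatrix v p i j * K j = 0 := by
  have hcont : Continuous fun y => ∑ i, K i * v y i :=
    continuous_finsetSum _ fun i _ => continuous_const.mul (hv.apply i).continuous
  obtain ⟨p, -, hp⟩ := exists_forall_partialDeriv_eq_zero hcont
  refine ⟨p, fun i => ?_⟩
  -- `∂ᵢ(K·v)(p) = ∑ⱼ Kⱼ ∂ᵢvⱼ(p) = 0`
  have hgrad : ∑ j, K j * Torus.partialDeriv i v p j = 0 := by
    have hs : ∀ j, Torus.IsContDiff 1 (fun y => K j * v y j) :=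
      fun j => ContDiff.mul contDiff_const ((hv.apply j).isContDiff (by simp))
    have h := hp i
    rw [partialDeriv_finset_sum _ (fun j _ => hs j)] at h
    rw [← h]
    refine Finset.sum_congr rfl fun j _ => ?_
    rw [show (fun y => K j * v y j) = K j • fun y => v y j from rfl,
      partialDeriv_const_smul ((hv.apply j).isContDiff (by simp)), Pi.smul_apply, smul_eq_mul,
      partialDeriv_apply_coord (hv.isContDiff (by simp))]
  -- `(∂_K v)ᵢ(p) = ∑ⱼ Kⱼ ∂ⱼvᵢ(p) = 0`
  have hdir : ∑ j, K j * Torus.partialDeriv j v p i = 0 := by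
    have h := congrArg (fun z : EuclideanSpace ℝ d => z i) (hK p)
    simpa [Finset.sum_apply] using h
  have hsum : ∑ j, torusStrainMatrix v p i j * K j =
      (∑ j, K j * Torus.partialDeriv j v p i + ∑ j, K j * Torus.partialDeriv i v p j) / 2 := by
    rw [add_div, Finset.sum_div, Finset.sum_div, ← Finset.sum_add_distrib]
    refine Finset.sum_congr rfl fun j _ => ?_
    rw [torusStrainMatrix_apply]
    ring
  rw [hsum, hdir, hgrad]
  simp

end Field

/-! ## 4. (4b)(ii) for an arbitrary direction of invariance -/

/-- Algebra: a biaxial matrix `m(1 − 3n⊗n)`, `m ≠ 0`, `|n| = 1`, annihilates no non-zero vector: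
`m(K − 3(n·K)n) = 0 ⇒ n·K = 3(n·K) ⇒ n·K = 0 ⇒ K = 0`. [ours] -/
theorem biaxial_mulVec_ne_zero {m : ℝ} (hm : m ≠ 0) {n : d → ℝ} (hn1 : ∑ i, n i ^ 2 = 1)
    {K : d → ℝ} (hK : K ≠ 0)
    (h : ∀ i, ∑ j, (m • (1 - (3 : ℝ) • Matrix.vecMulVec n n) : Matrix d d ℝ) i j * K j = 0) : False := by
  have he : ∀ i, m * K i - 3 * m * n i * (∑ j, n j * K j) = 0 := by
    intro i
    have hi := h i
    simp only [Matrix.smul_apply, Matrix.sub_apply, Matrix.one_apply, Matrix.vecMulVec_apply, smul_eq_mul] at hi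
    have e1 : ∑ j, m * ((if i = j then 1 else 0) - 3 * (n i * n j)) * K j =
        ∑ j, ((if i = j then m * K j else 0) - 3 * m * n i * (n j * K j)) :=
      Finset.sum_congr rfl fun j _ => by split_ifs <;> ring
    rw [e1, Finset.sum_sub_distrib, Finset.sum_ite_eq, if_pos (Finset.mem_univ i), ← Finset.mul_sum] at hi
    exact hi
  set c := ∑ j, n j * K j with hc
  have hKi : ∀ i, K i = 3 * (n i * c) := fun i => by
    have h1 := he i
    have h2 : m * (K i - 3 * (n i * c)) = 0 := by linear_combination h1
    have := (mul_eq_zero.mp h2).resolve_left hm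
    linarith
  have hdot : c = 3 * c := by
    calc c = ∑ i, n i * K i := hc
      _ = ∑ i, n i * (3 * (n i * c)) := Finset.sum_congr rfl fun i _ => by rw [hKi i]
      _ = 3 * c * ∑ i, n i ^ 2 := by
          rw [Finset.mul_sum]; exact Finset.sum_congr rfl fun i _ => by ring
      _ = 3 * c := by rw [hn1, mul_one]
  have hc0 : c = 0 := by linarith
  apply hK
  funext i
  rw [hKi i, hc0]
  simp

/-- **THE EIKONAL OBSTRUCTION FOR AN ARBITRARY DIRECTION OF INVARIANCE.** There is no smooth field `v` on
`T^d` with `S(v)(x) = m(1 − 3 n(x)⊗n(x))`, `m ≠ 0`, `∑ᵢ nᵢ² = 1`, whose axis is invariant under the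
translations `x ↦ x + proj(tK)` for some `K ≠ 0` (any real direction). SIEVELD §3.4b (4b)(ii) is the case
`K = eₖ` (`no_biaxial_strain_of_axis_invariant`). [ours] -/
theorem no_biaxial_strain_of_axis_invariant_dir {v : UnitAddTorus d → EuclideanSpace ℝ d}
    (hv : Torus.IsSmooth v) {m : ℝ} (hm : m ≠ 0) {K : EuclideanSpace ℝ d} (hK : K ≠ 0)
    {n : UnitAddTorus d → d → ℝ} (hn1 : ∀ x, ∑ i, n x i ^ 2 = 1)
    (hnK : ∀ (x : UnitAddTorus d) (t : ℝ), n (x + proj (t • K)) = n x)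
    (hS : ∀ x, torusStrainMatrix v x = m • (1 - (3 : ℝ) • Matrix.vecMulVec (n x) (n x))) : False := by
  have hinv : ∀ (x : UnitAddTorus d) (t : ℝ), torusStrainMatrix v (x + proj (t • K)) = torusStrainMatrix v x :=
    fun x t => by rw [hS, hS, hnK]
  have hdir := dirDeriv_eq_zero_of_strain_invariant_dir hv K hinv
  obtain ⟨p, hp⟩ := exists_strain_mulVec_eq_zero_dir hv K hdir
  have hK' : (fun j => K j) ≠ 0 := by
    intro h0; apply hK; ext j; exact congrFun h0 j
  exact biaxial_mulVec_ne_zero hm (hn1 p) hK' fun i => by rw [← hS p]; exact hp i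

/-- **Variable modulus, arbitrary direction.** If `∂_K v ≡ 0` for some `K ≠ 0` (e.g. `v` invariant along
`K`), then `v` is not biaxial at every point even with modulus `m(x) ≠ 0` and axis `n_x` varying from
point to point: at the point `p` with `S(v)(p)K = 0` (`exists_strain_mulVec_eq_zero_dir`) a biaxial matrix
would annihilate `K` (`biaxial_mulVec_ne_zero`). The arbitrary-direction form of
`no_biaxial_strain_of_partialDeriv_eq_zero`. [ours] -/
theorem no_biaxial_strain_of_dirDeriv_eq_zero {v : UnitAddTorus d → EuclideanSpace ℝ d}
    (hv : Torus.IsSmooth v) {K : EuclideanSpace ℝ d} (hK : K ≠ 0)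
    (hKv : ∀ x, ∑ l, K l • Torus.partialDeriv l v x = 0) {m : UnitAddTorus d → ℝ} (hm : ∀ x, m x ≠ 0)
    (hS : ∀ x, ∃ n : d → ℝ, ∑ i, n i ^ 2 = 1 ∧
      torusStrainMatrix v x = m x • (1 - (3 : ℝ) • Matrix.vecMulVec n n)) : False := by
  obtain ⟨p, hp⟩ := exists_strain_mulVec_eq_zero_dir hv K hKv
  obtain ⟨n, hn1, hSp⟩ := hS p
  have hK' : (fun j => K j) ≠ 0 := by
    intro h0; apply hK; ext j; exact congrFun h0 j
  exact biaxial_mulVec_ne_zero (hm p) hn1 hK' fun i => by rw [← hSp]; exact hp i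

end BiaxialEikonal

end Summit.NavierStokesRegularity.FunctionalMining

end
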